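import Summits.AtomisticToContinuum.BoseEinsteinCondensation.Theorems.BECThomsonPrincipleFibreConductanceStubThomson
import Summits.AtomisticToContinuum.BoseEinsteinCondensation.Theorems.BECThomsonPrincipleFibreConductanceStubTwoScaleSplitHelpers
import Summits.AtomisticToContinuum.BoseEinsteinCondensation.Theorems.BECThomsonPrincipleFibreConductanceCageDefs
import Literature.MathematicalPhysics.QuantumManyBody.GeneralizedPoincareProofs
import HarnessLib

/-!
# Route `BECThomsonPrinciple`, crux `FibreConductance` (stmt-AtomisticToContinuum-9480):
# vocabulary, stub statements and composition of the line `conditional-law-poincare`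

Route-posited objects (D-0016 `<Route>Defs`-type file; precedents `BECThomsonPrincipleDefs.lean`,
`BECThomsonPrincipleFibreConductanceHealingDefs.lean`, `…CageDefs.lean`) shared by the registered stubs of
the checked skeleton `Cruxes/FibreConductance/Lines/conditional_law_poincare.lean` (lead seat c2,
prover-line-stmt-AtomisticToContinuum-9480-c2-0; `ledger skeleton check` OK, stubs
`stub_weightedSobolevPoincare`, `stub_localChargeSq`, `stub_localToGlobal`, `stub_momentOfCDM`,
`stub_conditionalDensityMoments`, `stub_coarseBeatDual`, `stub_bottomMode`). NOTHING IS ASSERTED here: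
every `def … : Prop` below is a *statement* (a stub signature or an intermediate goal), consumed only
as the type of a stub theorem or as a hypothesis of the sorry-free composition `FibreConductance_of`
(registered bookkeeping stub `conditional_compose`, proved at the end); the stub theorems land one per
file under `Theorems/BECThomsonPrincipleFibreConductanceStub<Name>.lean` (`--supports` the crux item).

**The crux** (`Theses/BECThomsonPrinciple.lean`, `def FibreConductance`): for bounded repulsive
finite-range `v`, every window parameter `M`, every exact zero-free `C¹` minimiser `Φ` on the torus and
every window mode `k = 2πn/L`, `2π‖n‖/L ≤ M√ρ`: ONE flow `J` in the `x₀`-fibre with weak divergence the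
fibre-neutral charge `q = L^{-3/2}(e^{ik·x₀}ψ − βψ²)` and cost `∫|J|²W/ψ² ≤ C L²/‖n‖²`.

**The line (planner skeleton `Lines/conditional-law-poincare.lean`, idea `conditional-law-poincare`),
reshaped by the lead into DUAL + SOBOLEV form over the LANDED vocabulary** (`BECThomsonPrincipleDefs`:
`fibreW`, `fibrePsi`, `fibreBeta`, `phase`, `LowDensityWindow`; `…HealingDefs`: `IsTest`, `dualEnergy`,
`HasDualBound`, `ThomsonRealisation`/`stub_thomson` (p103256), `side`, `cubeSet`, `cubeIdx`, `cubeAvg`;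
`…CageDefs`: `ConditionalDensityMoments` (gen 1's shared landscape input); cf. `…DualForm`
(`fibreConductance_iff_dual : FibreConductance ↔ FibreDualBound`, p104461) for the equivalence).

By Thomson duality (`stub_thomson` + `norm_pairing_sq_le`) the crux is the pure inequality
`‖∫_{cellN} q η‖² ≤ (CL²/‖n‖²)·E(η)`, `E(η) = ∫|∇₀η|²ψ²/W`, for `C¹` periodic test functions `η`
(`CruxDualBound`; realisation `fibreConductance_of_cruxDualBound`): no flow is constructed by this line. Tile
each fibre `[0,L)³` by the `ν_n³ = ‖n‖_∞³` WAVELENGTH cubes `Q` of side `ℓ = L/‖n‖_∞` (block count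
`waveBlocks n = ‖n‖_∞ − 1` in the `(ν+1)³` convention of `HealingDefs`) and split the charge as the
planner does, `q = q_loc + q_c` with the COARSE charge `q_c = ψ²·c_Q/μ_Q` on `Q ∋ x₀`
(`c_Q = ∫_Q q dy` the total cube charge, `μ_Q = ∫_Q ψ² dy` the cube mass) and the LOCAL charge
`q_loc = q − q_c = L^{-3/2}(e^{ik·y}ψ − ψ²A_Q/μ_Q)`, `A_Q = ∫_Q e^{ik·z}ψ` (Lebesgue-neutral on every
cube; `β` cancels). Then:

* `stub_localToGlobal` (deterministic, the lead's; GENERIC in a continuous charge `ρ`): for EVERY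
  zero-free state, block count `ν` and level `B`, a dual bound `‖∫ρ_cη‖² ≤ B·E(η)` of the coarse part
  gives `‖∫ρη‖² ≤ (2C·sobolevLevelOf ρ + 2B)·E(η)`.
  Mechanism: `∫qη = ∫q_loc(η − Πη) + ∫q_cη` EXACTLY (`Πη` = flat block average; the cross term
  `∫q_loc·Πη` vanishes fibrewise by cube-neutrality of `q_loc`); on each cube FLAT Cauchy–Schwarz
  `|∫_Q q_loc(η−⨍_Qη)| ≤ ‖q_loc‖_{L²(Q)}‖η − ⨍_Qη‖_{L²(Q)}` and the WEIGHTED SOBOLEV–POINCARÉ bound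
  of `stub_weightedSobolevPoincare` (`∫_Q|f−⨍f|² ≤ C(∫_Q|∇f|²ψ²)(∫_Qψ⁻³)^{2/3}` — the tree's
  Poincaré–Sobolev inequality on cubes `GenPoincare.poincare_sobolev_cube`, `L^{6/5} → L²`, plus
  Hölder), then Cauchy–Schwarz over cubes and over the bath with weights `W`, `1/W` (c1's `high_sq_le`
  pattern). NO local Poincaré constant of the conditional law appears: it is replaced by the explicit
  hole moment `(∫_Qψ⁻³)^{2/3}` — this is how the planner's `stub_localToGlobal` (Lax–Milgram) and the
  Poincaré-constant half of `stub_localPoincareMoment` are discharged at once.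
* `stub_momentOfCDM` (deterministic): the bath moment `sobolevLevel = L⁻³∫_{cellN} W Σ_Q U_Q P_Q`
  (`U_Q = ∫_Q|q_loc|²`, `P_Q = (∫_Qψ⁻³)^{2/3}`) is `≤ A L²/‖n‖²` given `stub_localChargeSq`
  (`U_Q ≤ 2L⁻³(μ_Q + ℓ³∫_Qψ⁴/μ_Q)`, Cauchy–Schwarz on `A_Q`) and gen 1's
  `ConditionalDensityMoments` at `p = 6` (cube averages `m_k = ⨍_Q g^k` of `g = L³ψ²`:
  `U_QP_Q ≤ 2L⁻³ℓ⁵(m₁ + m₂/m₁)m_{-3/2}^{2/3}`, Young + Jensen `≤ Cℓ⁵L⁻³⨍_Q(g⁶ + g⁻⁶ + 2)`, fibre Fubini).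
  Free gas: `A_Q = 0` on commensurate cubes, `U_Q = L⁻⁶ℓ³`, `P_Q = L³ℓ²`, `sobolevLevel = ℓ² = L²/‖n‖_∞²`.
* `stub_conditionalDensityMoments` (OPEN; gen 1's `stub_conditionalDensityMoments` VERBATIM — the
  cage/fluidity half of the crux, k-free, shared by two lines now).
* `stub_coarseBeatDual` (OPEN, HARDEST, the crux's infrared content; only for `‖n‖_∞ ≥ 2`): the coarse
  charge has dual bound `‖∫q_cη‖² ≤ (BL²/‖n‖²)E(η)`. With μ-WEIGHTED block averages `q_c`'s pairing is
  EXACTLY a lattice pairing `Σ_Q c_Q⟨η⟩_{μ,Q}` on the `‖n‖_∞³` torus grid, so the stub is a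
  random-conductance lattice `H⁻¹` bound for the cube charges `c_Q` (coarse cages ⇐ Sobolev on double
  cubes ⇐ CDM; flat beat sum ⇐ `ShellOccupation` + kinetic budget) — `infraredNecessity` (p90785) applies
  to it verbatim at the window top; not attacked by energy here.
* `stub_bottomMode` (deterministic): one cube (`ν = 0`) ⇒ `c_Q = ∫_cell q = L^{-3/2}(β − β∫ψ²) = 0`
  ⇒ `q_c ≡ 0`: at the bottom modes `‖n‖_∞ = 1` the crux is `stub_localToGlobal` +
  `stub_momentOfCDM` + `ConditionalDensityMoments` ALONE.

Composition (sorry-free, §2): `FibreConductance_of wsp lcs lg mc cdm cb bm =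
fibreConductance_iff_dual.mpr (fibreDualBound_of (lg wsp) (mc lcs cdm) cb bm)`, constants
`ρ₀ = min`, `N₀ = max`, `C = 2C_PS·A + 2B`.

Disproof v7 obligations: see the skeleton `Lines/conditional_law_poincare.lean` ((H1) binds exactly the two
open stubs; §E floor and §Infrared respected).
-/

noncomputable section

namespace Summit.AtomisticToContinuum.BoseEinsteinCondensation.Cruxes.FibreConductance.ConditionalLawPoincare

open MeasureTheory
open scoped ENNReal
open Literature.MathematicalPhysics.QuantumManyBody.BoseGas
open Summit.AtomisticToContinuum.BoseEinsteinCondensation.Theses.BECThomsonPrinciple (FibreConductance)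
open Summit.AtomisticToContinuum.BoseEinsteinCondensation.Cruxes.FibreConductance.ParsevalShellBootstrap
open Summit.AtomisticToContinuum.BoseEinsteinCondensation.Cruxes.FibreConductance.HealingSplitKineticDefect
open Summit.AtomisticToContinuum.BoseEinsteinCondensation.Cruxes.FibreConductance.TaggedPathHarnack
  (ConditionalDensityMoments)

variable {m : ℕ} {L : ℝ}

/-! ## §(-1) The crux's charge and the realisation glue -/

/-- The crux's fibre-neutral charge `q = L^{-3/2}(e^{ik·x₀}ψ − βψ²)` — verbatim the crux's `let q` over
the landed vocabulary; = `HealingSplitKineticDefect.fibreCharge` of `…FibreConductanceDualForm` (same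
body, `rfl`), kept under its own name so that this vocabulary does not depend on that module. [folklore] -/
def cruxCharge (n : Fin 3 → ℤ) (Φ : PeriodicTrialState (m + 1) L) (X : Config (m + 1)) : ℂ :=
  ((Real.sqrt (L ^ 3))⁻¹ : ℂ) *
    (phase L n (X 0) * (fibrePsi Φ X : ℂ) - fibreBeta n Φ X * (fibrePsi Φ X : ℂ) ^ 2)

/-- The charge `q` of a zero-free state is continuous (`L > 0`). [folklore] -/
theorem continuous_cruxCharge (hL : 0 < L) (n : Fin 3 → ℤ) (Φ : PeriodicTrialState (m + 1) L)
    (hΦ : ∀ X, Φ.ψ X ≠ 0) : Continuous (cruxCharge n Φ) := by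
  have hphase : Continuous (phase L n) := (contDiff_phase L n (k := 0)).continuous
  have hψ := continuous_fibrePsi hL Φ hΦ
  have hβ := continuous_fibreBeta hL n Φ hΦ
  unfold cruxCharge
  fun_prop

/-- THE CRUX IN DUAL FORM (= `HealingSplitKineticDefect.FibreDualBound`; a reformulation of
`FibreConductance`, not a literature fact): in the crux's window, for exact zero-free minimisers,
`‖∫ q η‖² ≤ (C L²/‖n‖²)·∫|∇₀η|²ψ²/W` for every `C¹` periodic test function `η`. -/
def CruxDualBound : Prop :=
  LowDensityWindow fun _ L n Φ C =>
    HasDualBound Φ (cruxCharge n Φ) (ENNReal.ofReal (C * L ^ 2 / ‖(fun j => (n j : ℝ))‖ ^ 2))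

/-- **Dual bound ⇒ crux** by the landed realisation half of Thomson duality `stub_thomson`
(= `HealingSplitKineticDefect.fibreConductance_of_dualBound stub_thomson`). [folklore] -/
theorem fibreConductance_of_cruxDualBound (hd : CruxDualBound) : FibreConductance := by
  intro v hv hB M hM
  obtain ⟨ρ₀, C, hρ₀, hC, N₀, h⟩ := hd v hv hB M hM
  refine ⟨ρ₀, C, hρ₀, hC, N₀, fun m hm L hL hρ n hn hw Φ hE hz => ?_⟩
  obtain ⟨J, -, hJd, hJc⟩ := stub_thomson m L hL Φ hz (cruxCharge n Φ)
    (continuous_cruxCharge hL n Φ hz) _ (by positivity) (h m hm L hL hρ n hn hw Φ hE hz)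
  exact ⟨J, hJd, hJc⟩

/-! ## §0 The wavelength tiling and the local / coarse split of the crux's charge -/

/-- `‖n‖_∞ = max_j |n_j|` as a natural number (`≥ 1` for `n ≠ 0`; the crux's norm
`‖(fun j => (n j : ℝ))‖` is this sup norm). [folklore] -/
def supIdx (n : Fin 3 → ℤ) : ℕ :=
  Finset.univ.sup fun j => (n j).natAbs

/-- Block count of the WAVELENGTH tiling: `waveBlocks n + 1 = ‖n‖_∞` cubes per axis, side
`ℓ = side L (waveBlocks n) = L/‖n‖_∞` (for `n ≠ 0`; `ℕ`-subtraction, `0` at `n = 0` — never used there).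
Each cube spans whole periods of `e^{ik·y}` in a direction where `|n_j| = ‖n‖_∞`. [folklore] -/
def waveBlocks (n : Fin 3 → ℤ) : ℕ :=
  supIdx n - 1

/-- CUBE MASS `μ_Q(X̂) = ∫_Q ψ(y|X̂)² dy` of the conditional law (`Σ_Q μ_Q = 1`; `> 0`). [folklore] -/
def cubeMass (L : ℝ) (ν : ℕ) (Φ : PeriodicTrialState (m + 1) L) (Q : Fin 3 → Fin (ν + 1))
    (X : Config (m + 1)) : ℝ :=
  ∫ y in cubeSet L ν Q, fibrePsi Φ (Function.update X 0 y) ^ 2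

/-- TOTAL CUBE CHARGE `c_Q(X̂) = ∫_Q ρ(y, X̂) dy` of a charge `ρ` on the cube `Q` of the fibre through
`X` (for the crux's charge: `= L^{-3/2}(∫_Q e^{ik·z}ψ − βμ_Q)`, `Σ_Q c_Q = 0`). [folklore] -/
def cubeChargeOf (L : ℝ) (ν : ℕ) (ρ : Config (m + 1) → ℂ) (Q : Fin 3 → Fin (ν + 1))
    (X : Config (m + 1)) : ℂ :=
  ∫ y in cubeSet L ν Q, ρ (Function.update X 0 y)

/-- COARSE PART `ρ_c(X) = ψ(X)² · c_{Q(x₀)}(X̂)/μ_{Q(x₀)}(X̂)` of a charge: `μ`-proportional on each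
cube, total charge `c_Q` on `Q`. For the crux's charge: the COARSE BEAT CHARGE `q_c` (`≡ 0` when
`ν = 0` and at `v = 0`). [folklore] -/
def coarseOf (L : ℝ) (ν : ℕ) (Φ : PeriodicTrialState (m + 1) L) (ρ : Config (m + 1) → ℂ)
    (X : Config (m + 1)) : ℂ :=
  ((fibrePsi Φ X ^ 2 : ℝ) : ℂ) *
    (cubeChargeOf L ν ρ (cubeIdx L ν (X 0)) X / (cubeMass L ν Φ (cubeIdx L ν (X 0)) X : ℂ))

/-- LOCAL PART `ρ_loc = ρ − ρ_c` of a charge (`∫_Q ρ_loc dy = 0` on every cube of every fibre). For the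
crux's charge: `q_loc = L^{-3/2}(e^{ik·y}ψ − ψ²A_Q/μ_Q)`, `A_Q = ∫_Q e^{ik·z}ψ`. [folklore] -/
def localOf (L : ℝ) (ν : ℕ) (Φ : PeriodicTrialState (m + 1) L) (ρ : Config (m + 1) → ℂ)
    (X : Config (m + 1)) : ℂ :=
  ρ X - coarseOf L ν Φ ρ X

/-- LOCAL CHARGE SQUARE `U_Q(X̂) = ∫_Q |ρ_loc(y, X̂)|² dy` (flat, no weight). [folklore] -/
def localSqOf (L : ℝ) (ν : ℕ) (Φ : PeriodicTrialState (m + 1) L) (ρ : Config (m + 1) → ℂ)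
    (Q : Fin 3 → Fin (ν + 1)) (X : Config (m + 1)) : ℝ≥0∞ :=
  ∫⁻ y in cubeSet L ν Q, ‖localOf L ν Φ ρ (Function.update X 0 y)‖ₑ ^ 2

/-- HOLE FACTOR `P_Q(X̂) = (∫_Q ψ(y|X̂)⁻³ dy)^{2/3}` — the Sobolev substitute for the local Poincaré
constant of the conditional law on `Q` (charges holes of `ψ` by Lebesgue volume × depth^{3/2}).
[folklore] -/
def holeFactor (L : ℝ) (ν : ℕ) (Φ : PeriodicTrialState (m + 1) L) (Q : Fin 3 → Fin (ν + 1))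
    (X : Config (m + 1)) : ℝ≥0∞ :=
  (∫⁻ y in cubeSet L ν Q,
      ENNReal.ofReal ((fibrePsi Φ (Function.update X 0 y) ^ 2) ^ (-(3 / 2 : ℝ)))) ^ (2 / 3 : ℝ)

/-- SOBOLEV LEVEL `L⁻³ ∫_{cellN} (Σ_Q U_Q P_Q)·W dX = E_W[Σ_Q U_Q P_Q]` of a charge at block count `ν`
— the level at which its local part is dually bounded (crux's charge, free gas: `ℓ² = L²/‖n‖_∞²`).
[folklore] -/
def sobolevLevelOf (L : ℝ) (ν : ℕ) (Φ : PeriodicTrialState (m + 1) L) (ρ : Config (m + 1) → ℂ) :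
    ℝ≥0∞ :=
  (ENNReal.ofReal L ^ 3)⁻¹ *
    ∫⁻ X in cellN (m + 1) L,
      (∑ Q, localSqOf L ν Φ ρ Q X * holeFactor L ν Φ Q X) * ENNReal.ofReal (fibreW Φ X)

/-! ## §1 Statements of the stubs -/

/-- **Statement of `stub_weightedSobolevPoincare` — WEIGHTED SOBOLEV–POINCARÉ ON THE TILING CUBES
(deterministic; M).** There is `C < ∞` such that for every `L > 0`, block count `ν`, cube `Q` of the
tiling, every `C¹` function `f : ℝ³ → ℂ` and every continuous positive weight `w`,
`∫_Q |f − ⨍_Q f|² ≤ C · (∫_Q w|∇f|²) · (∫_Q w^{-3/2})^{2/3}`. Proof: the cube `Q` is the translate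
`ℓQ + [0,ℓ)³` of `cell ℓ`; the tree's Poincaré–Sobolev inequality on cubes
`GenPoincare.poincare_sobolev_cube` (`‖f − ⨍f‖_{L²} ≤ C_PS‖∇f‖_{L^{6/5}}`, all `C¹` `f`, scale-free)
after the translation `f(ℓQ + ·)`, then Hölder `∫|∇f|^{6/5} ≤ (∫w|∇f|²)^{3/5}(∫w^{-3/2})^{2/5}`.
(A statement of this line, proved in `…StubWeightedSobolevPoincare`; refs: LSSY2005 Lemma 4.1 — the
Poincaré–Sobolev step.) -/
def WeightedSobolevPoincare : Prop :=
  ∃ C : ℝ≥0∞, C ≠ ⊤ ∧ ∀ (L : ℝ), 0 < L → ∀ (ν : ℕ) (Q : Fin 3 → Fin (ν + 1)) (f : Space → ℂ),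
    ContDiff ℝ 1 f → ∀ w : Space → ℝ, Continuous w → (∀ y, 0 < w y) →
      ∫⁻ y in cubeSet L ν Q, ‖f y - ⨍ z in cubeSet L ν Q, f z‖ₑ ^ 2 ≤
        C * (∫⁻ y in cubeSet L ν Q, ENNReal.ofReal (w y) * gradSqC f y) *
          (∫⁻ y in cubeSet L ν Q, ENNReal.ofReal (w y ^ (-(3 / 2 : ℝ)))) ^ (2 / 3 : ℝ)

/-- **Statement of `stub_localChargeSq` — THE LOCAL CHARGE IS SMALL IN `L²` (deterministic; M; written
over the landed vocabulary `BECThomsonPrincipleDefs`: `q` and `q_loc` written out).** For every zero-free state, `ν`, `n`, cube `Q` and fibre: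
`∫_Q |q − ψ²·(∫_Q q)/(∫_Q ψ²)|² dy ≤ (2/L³)(μ_Q + ℓ³(∫_Qψ⁴)/μ_Q)`, `μ_Q = ∫_Qψ²`. Proof:
`q − ψ²c_Q/μ_Q = L^{-3/2}(e^{ik·y}ψ − ψ²A_Q/μ_Q)` with `A_Q = ∫_Q e^{ik·z}ψ` (`β` cancels: `β`, `c_Q`,
`μ_Q` are fibre constants — `fibreBeta_update`), `|a − b|² ≤ 2|a|² + 2|b|²`, `|e^{ik·y}| = 1`, and
Cauchy–Schwarz `|A_Q|² ≤ |Q|·μ_Q`, `|Q| = ℓ³ = side L ν ^ 3`. (A statement of this line, proved in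
`…StubLocalChargeSq`.) -/
def LocalChargeSqBound : Prop :=
  ∀ (m : ℕ) (L : ℝ), 0 < L → ∀ (ν : ℕ) (n : Fin 3 → ℤ) (Φ : PeriodicTrialState (m + 1) L),
    (∀ X, Φ.ψ X ≠ 0) → ∀ (Q : Fin 3 → Fin (ν + 1)) (X : Config (m + 1)),
      ∫ y in cubeSet L ν Q, ‖((Real.sqrt (L ^ 3))⁻¹ : ℂ) *
            (phase L n (Function.update X 0 y 0) * (fibrePsi Φ (Function.update X 0 y) : ℂ) -
              fibreBeta n Φ (Function.update X 0 y) * (fibrePsi Φ (Function.update X 0 y) : ℂ) ^ 2) -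
          ((fibrePsi Φ (Function.update X 0 y) ^ 2 : ℝ) : ℂ) *
            ((∫ z in cubeSet L ν Q, ((Real.sqrt (L ^ 3))⁻¹ : ℂ) *
                (phase L n (Function.update X 0 z 0) * (fibrePsi Φ (Function.update X 0 z) : ℂ) -
                  fibreBeta n Φ (Function.update X 0 z) *
                    (fibrePsi Φ (Function.update X 0 z) : ℂ) ^ 2)) /
              ((∫ z in cubeSet L ν Q, fibrePsi Φ (Function.update X 0 z) ^ 2 : ℝ) : ℂ))‖ ^ 2 ≤
        2 / L ^ 3 * ((∫ z in cubeSet L ν Q, fibrePsi Φ (Function.update X 0 z) ^ 2) +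
          side L ν ^ 3 * (∫ z in cubeSet L ν Q, fibrePsi Φ (Function.update X 0 z) ^ 4) /
            (∫ z in cubeSet L ν Q, fibrePsi Φ (Function.update X 0 z) ^ 2))

/-- LOCAL-TO-GLOBAL IN DUAL FORM (conclusion of `stub_localToGlobal`; a statement, not a cited fact):
there is `C < ∞` such that for EVERY zero-free state, block count `ν`, CONTINUOUS charge `ρ` and
level `B`, a dual bound of the coarse part `ρ_c` at level `B` gives the dual bound of `ρ` at level
`2C·sobolevLevelOf ρ + 2B` (generic two-scale tool; the line uses it for the crux's charge at the
wavelength tiling). -/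
def LocalToGlobal : Prop :=
  ∃ C : ℝ≥0∞, C ≠ ⊤ ∧ ∀ (m : ℕ) (L : ℝ), 0 < L → ∀ (ν : ℕ) (Φ : PeriodicTrialState (m + 1) L),
    (∀ X, Φ.ψ X ≠ 0) → ∀ ρ : Config (m + 1) → ℂ, Continuous ρ →
      ∀ B : ℝ≥0∞, HasDualBound Φ (coarseOf L ν Φ ρ) B →
        HasDualBound Φ ρ (2 * C * sobolevLevelOf L ν Φ ρ + 2 * B)

/-- SOBOLEV MOMENT BOUND (conclusion of `stub_momentOfCDM`; the line's LEVER in Sobolev form; a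
statement): in the crux's window, for exact zero-free minimisers, `sobolevLevel ≤ A·L²/‖n‖²` at the
wavelength tiling. Free gas: `A = 1`. -/
def SobolevMomentBound : Prop :=
  LowDensityWindow fun _ L n Φ A =>
    sobolevLevelOf L (waveBlocks n) Φ (cruxCharge n Φ) ≤
      ENNReal.ofReal (A * L ^ 2 / ‖(fun j => (n j : ℝ))‖ ^ 2)

/-- **Statement of `stub_coarseBeatDual` — THE COARSE BEAT CHARGE IN DUAL FORM (OPEN; HARDEST; uses
(H1); only `‖n‖_∞ ≥ 2`).** In the crux's window, for exact zero-free minimisers and `‖n‖_∞ ≥ 2`, the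
coarse charge `q_c = ψ²c_Q/μ_Q` of the wavelength tiling has dual bound `‖∫q_cη‖² ≤ (BL²/‖n‖²)·E(η)`.
Content: with `μ`-weighted block averages `⟨η⟩_{μ,Q} = μ_Q⁻¹∫_Qηψ²`, `∫_cell q_cη dy = Σ_Q c_Q⟨η⟩_{μ,Q}`
EXACTLY, so this is the lattice `H⁻¹(conductances)` bound for the neutral cube charges `(c_Q)` on the
`‖n‖_∞³` torus grid; its flat version is the beat sum `Σ_{|P|≲‖n‖_∞/L}|q̂(P)|²/P²` (empty-to-`O(ℓ²ρaL²)`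
by the kinetic budget, at the window top the single-mode occupation content `infraredNecessity` p90785
forces — `ShellOccupation`-shaped). Vacuous at `‖n‖_∞ = 1` (`stub_bottomMode`), `= 0` at `v = 0`
(`A_Q = 0` on commensurate cubes, `β = 0`). Why it might fail: it is the crux's thermodynamic-limit
content (an `O(L)` single-mode occupation bound for exact ground states no energy method gives); false
for non-minimisers. (Refs: LyonsPeres2016 Ch. 2; GrimmettKestenZhang1993; KennedyLiebShastry1988.) -/
def CoarseBeatDualBound : Prop :=
  LowDensityWindow fun _ L n Φ B => 2 ≤ supIdx n →
    HasDualBound Φ (coarseOf L (waveBlocks n) Φ (cruxCharge n Φ))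
      (ENNReal.ofReal (B * L ^ 2 / ‖(fun j => (n j : ℝ))‖ ^ 2))

/-- **Statement of `stub_bottomMode` — ONE CUBE CARRIES NO COARSE CHARGE (deterministic; S; over the
landed vocabulary `BECThomsonPrincipleDefs`, `q` written out).** With block count `0` the single cube is the cell, and the total charge of the
crux's charge on a fibre vanishes: `∫_cell q dy = L^{-3/2}(β − β·∫_cellψ²) = 0`
(`integral_fibrePsi_sq`, the definition of `fibreBeta`, fibre constancy `fibreBeta_update`). (A statement
of this line, proved in `…StubBottomMode`.) -/
def BottomModeNeutral : Prop :=
  ∀ (m : ℕ) (L : ℝ), 0 < L → ∀ (n : Fin 3 → ℤ) (Φ : PeriodicTrialState (m + 1) L),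
    (∀ X, Φ.ψ X ≠ 0) → ∀ (Q : Fin 3 → Fin 1) (X : Config (m + 1)),
      ∫ y in cubeSet L 0 Q, ((Real.sqrt (L ^ 3))⁻¹ : ℂ) *
          (phase L n (Function.update X 0 y 0) * (fibrePsi Φ (Function.update X 0 y) : ℂ) -
            fibreBeta n Φ (Function.update X 0 y) * (fibrePsi Φ (Function.update X 0 y) : ℂ) ^ 2) = 0

/-! ### Audit names of the stub statements (`Goal.stub_x` = statement of the registered `stub_x`) -/

namespace Goal

/-- Statement of `stub_weightedSobolevPoincare`. -/
abbrev stub_weightedSobolevPoincare : Prop := WeightedSobolevPoincare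
/-- Statement of `stub_localChargeSq`. -/
abbrev stub_localChargeSq : Prop := LocalChargeSqBound
/-- Statement of `stub_localToGlobal` (the lead's): the weighted Sobolev–Poincaré tool gives the
local-to-global dual bound. -/
abbrev stub_localToGlobal : Prop := WeightedSobolevPoincare → LocalToGlobal
/-- Statement of `stub_momentOfCDM`: the local charge bound and gen 1's `ConditionalDensityMoments`
give the Sobolev moment bound. -/
abbrev stub_momentOfCDM : Prop := LocalChargeSqBound → ConditionalDensityMoments → SobolevMomentBound
/-- Statement of `stub_conditionalDensityMoments` (VERBATIM gen 1's shared landscape input). -/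
abbrev stub_conditionalDensityMoments : Prop := ConditionalDensityMoments
/-- Statement of `stub_coarseBeatDual`. -/
abbrev stub_coarseBeatDual : Prop := CoarseBeatDualBound
/-- Statement of `stub_bottomMode`. -/
abbrev stub_bottomMode : Prop := BottomModeNeutral
/-- Statement of the bookkeeping stub `conditional_compose`: the seven stub statements imply the crux
BY NAME. -/
abbrev conditional_compose : Prop :=
  stub_weightedSobolevPoincare → stub_localChargeSq → stub_localToGlobal → stub_momentOfCDM →
    stub_conditionalDensityMoments → stub_coarseBeatDual → stub_bottomMode → FibreConductance

end Goal

/-! ## §2 Glue (proved) and the composition -/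

/-- `n ≠ 0 ⇒ ‖n‖_∞ ≥ 1`. [folklore] -/
theorem one_le_supIdx {n : Fin 3 → ℤ} (hn : n ≠ 0) : 1 ≤ supIdx n := by
  obtain ⟨j, hj⟩ := Function.ne_iff.mp hn
  exact le_trans (Int.natAbs_pos.2 hj) (Finset.le_sup (f := fun j => (n j).natAbs) (Finset.mem_univ j))

/-- `‖n‖_∞ = 1 ⇒ waveBlocks n = 0` (one cube). [folklore] -/
theorem waveBlocks_eq_zero {n : Fin 3 → ℤ} (h : supIdx n = 1) : waveBlocks n = 0 := by simp [waveBlocks, h]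

/-- With block count `0` and a neutral fibre the coarse beat charge vanishes identically. [folklore] -/
theorem coarseOf_cruxCharge_zero_eq_zero (hbm : BottomModeNeutral) (hL : 0 < L) (n : Fin 3 → ℤ)
    (Φ : PeriodicTrialState (m + 1) L) (hΦ : ∀ X, Φ.ψ X ≠ 0) (X : Config (m + 1)) :
    coarseOf L 0 Φ (cruxCharge n Φ) X = 0 := by
  have h : cubeChargeOf L 0 (cruxCharge n Φ) (cubeIdx L 0 (X 0)) X = 0 := hbm m L hL n Φ hΦ _ X
  unfold coarseOf
  rw [h, zero_div, mul_zero]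

/-- The zero charge has dual bound `0`. [folklore] -/
theorem hasDualBound_zero (Φ : PeriodicTrialState (m + 1) L) {σ : Config (m + 1) → ℂ}
    (hσ : ∀ X, σ X = 0) : HasDualBound Φ σ 0 := fun η _ => by
  simp [show (fun X => σ X * η X) = fun _ => 0 from funext fun X => by rw [hσ X, zero_mul]]

/-- `ℝ≥0∞` bookkeeping for the final constant: `2·C·ofReal(Au) + 2·ofReal(Bu) ≤ ofReal((2C.toReal A + 2B)u)`
for `C ≠ ⊤`, `A, B, u ≥ 0`. [folklore] -/
theorem two_mul_mul_ofReal_add_le {C : ℝ≥0∞} (hC : C ≠ ⊤) {A B u : ℝ} (hA : 0 ≤ A) (hB : 0 ≤ B)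
    (hu : 0 ≤ u) :
    2 * C * ENNReal.ofReal (A * u) + 2 * ENNReal.ofReal (B * u) ≤
      ENNReal.ofReal ((2 * C.toReal * A + 2 * B) * u) := by
  have h2C : (0 : ℝ) ≤ 2 * C.toReal := by positivity
  rw [show (2 : ℝ≥0∞) * C * ENNReal.ofReal (A * u) = ENNReal.ofReal (2 * C.toReal * (A * u)) by
      rw [ENNReal.ofReal_mul h2C, ENNReal.ofReal_mul zero_le_two,
        ENNReal.ofReal_toReal hC, ENNReal.ofReal_ofNat],
    show (2 : ℝ≥0∞) * ENNReal.ofReal (B * u) = ENNReal.ofReal (2 * (B * u)) by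
      rw [ENNReal.ofReal_mul zero_le_two, ENNReal.ofReal_ofNat],
    ← ENNReal.ofReal_add (by positivity) (by positivity)]
  exact ENNReal.ofReal_le_ofReal (le_of_eq (by ring))

/-- **The dual bound of the crux from the line's four statements** (`ρ₀ = min`, `N₀ = max`,
`C = 2C_PS A + 2B`; case split on `‖n‖_∞ = 1` / `≥ 2` for the coarse charge). [folklore] -/
theorem fibreDualBound_of (hlg : LocalToGlobal) (hsm : SobolevMomentBound) (hcb : CoarseBeatDualBound)
    (hbm : BottomModeNeutral) : CruxDualBound := by
  obtain ⟨C, hCtop, hLG⟩ := hlg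
  intro v hv hbdd M hM
  obtain ⟨ρ₁, A, hρ₁, hA, N₁, h₁⟩ := hsm v hv hbdd M hM
  obtain ⟨ρ₂, B, hρ₂, hB, N₂, h₂⟩ := hcb v hv hbdd M hM
  refine ⟨min ρ₁ ρ₂, 2 * C.toReal * A + 2 * B, lt_min hρ₁ hρ₂, by positivity, max N₁ N₂, ?_⟩
  intro m hm L hL hρ n hn hwin Φ hE hΦ
  have hL3 : (0 : ℝ) ≤ L ^ 3 := by positivity
  have hρ₁' : ((m + 1 : ℕ) : ℝ) ≤ ρ₁ * L ^ 3 :=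
    hρ.trans (mul_le_mul_of_nonneg_right (min_le_left _ _) hL3)
  have hρ₂' : ((m + 1 : ℕ) : ℝ) ≤ ρ₂ * L ^ 3 :=
    hρ.trans (mul_le_mul_of_nonneg_right (min_le_right _ _) hL3)
  have hSM := h₁ m (le_of_max_le_left hm) L hL hρ₁' n hn hwin Φ hE hΦ
  have hu : 0 ≤ L ^ 2 / ‖(fun j => (n j : ℝ))‖ ^ 2 := by positivity
  set u : ℝ := L ^ 2 / ‖(fun j => (n j : ℝ))‖ ^ 2 with hu_def
  -- the coarse charge: zero at the bottom modes, `stub_coarseBeatDual` above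
  have hcoarse : HasDualBound Φ (coarseOf L (waveBlocks n) Φ (cruxCharge n Φ))
      (ENNReal.ofReal (B * u)) := by
    rcases Nat.lt_or_ge (supIdx n) 2 with hlt | hge
    · have h1 : supIdx n = 1 := le_antisymm (Nat.lt_succ_iff.mp hlt) (one_le_supIdx hn)
      rw [waveBlocks_eq_zero h1]
      exact (hasDualBound_zero Φ (coarseOf_cruxCharge_zero_eq_zero hbm hL n Φ hΦ)).mono bot_le
    · have h := h₂ m (le_of_max_le_right hm) L hL hρ₂' n hn hwin Φ hE hΦ hge
      rwa [hu_def, ← mul_div_assoc] at *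
  have hq := hLG m L hL (waveBlocks n) Φ hΦ (cruxCharge n Φ) (continuous_cruxCharge hL n Φ hΦ) _
    hcoarse
  refine hq.mono ?_
  calc 2 * C * sobolevLevelOf L (waveBlocks n) Φ (cruxCharge n Φ) + 2 * ENNReal.ofReal (B * u)
      ≤ 2 * C * ENNReal.ofReal (A * u) + 2 * ENNReal.ofReal (B * u) := by
        gcongr
        rwa [hu_def, ← mul_div_assoc]
    _ ≤ ENNReal.ofReal ((2 * C.toReal * A + 2 * B) * u) :=
        two_mul_mul_ofReal_add_le hCtop hA.le hB.le hu
    _ = ENNReal.ofReal ((2 * C.toReal * A + 2 * B) * L ^ 2 / ‖(fun j => (n j : ℝ))‖ ^ 2) := by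
        rw [hu_def, mul_div_assoc]

/-- **The line concludes the crux BY NAME** from its seven registered stubs:
`fibreConductance_of_cruxDualBound (fibreDualBound_of (lg wsp) (mc lcs cdm) cb bm)` (realisation by the landed `stub_thomson`). [folklore] -/
theorem FibreConductance_of (wsp : Goal.stub_weightedSobolevPoincare) (lcs : Goal.stub_localChargeSq)
    (lg : Goal.stub_localToGlobal) (mc : Goal.stub_momentOfCDM)
    (cdm : Goal.stub_conditionalDensityMoments) (cb : Goal.stub_coarseBeatDual)
    (bm : Goal.stub_bottomMode) : FibreConductance :=
  fibreConductance_of_cruxDualBound (fibreDualBound_of (lg wsp) (mc lcs cdm) cb bm)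

/-- **The registered bookkeeping stub `conditional_compose`, proved.** [folklore] -/
theorem conditional_compose : Goal.conditional_compose :=
  fun wsp lcs lg mc cdm cb bm => FibreConductance_of wsp lcs lg mc cdm cb bm

end Summit.AtomisticToContinuum.BoseEinsteinCondensation.Cruxes.FibreConductance.ConditionalLawPoincare

end
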